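import Literature.MathematicalPhysics.QuantumFieldTheory.Balaban1983to89.B16Ineq17BoxTorus
import Literature.MathematicalPhysics.QuantumFieldTheory.Balaban1983to89.B5AverageCurlStokes
import Literature.MathematicalPhysics.QuantumFieldTheory.Balaban1983to89.Beta.FluctuationProjection
import Literature.MathematicalPhysics.QuantumFieldTheory.Balaban1983to89.Beta.MonotoneScales

/-!
# `Balaban1983to89.B16Ineq17LocalFederbush` — [Balaban1989LargeFieldII] (1.7) p. 358 AT FLAT BACKGROUND WITH `γ₀ = 1`, from a
# LOCALIZED, WEIGHTED Federbush abelian stability inequality for Bałaban's typed linear average `Q_k` (B5 (1.18) = `B5Block118.QvOp`):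
# the two `O(e^{−R_k})` replacement steps of p. 357 and (1.65)–(1.67) [10] are NOT needed for the lower bound

statement-level skeleton of published theorems with citation tags; proofs where landed; nothing here is a claim about
the Yang–Mills mass gap.

T. Bałaban, *Large field renormalization. II. Localization, exponentiation, and bounds for the 𝐑 operation*, Commun. Math.
Phys. **122** (1989) 355–392 [Balaban1989LargeFieldII] (cell paper B16; PDF held `paper:balaban1989-cmp122-large-field-ii`, journal
page = PDF page + 354; pp. 356–358 = PDF 2–4, RE-READ AS IMAGES by this seat on the x2 renders
`run/shared/lean/pub/pub-balaban/b2b-balaban-ref1/pages/1989-cmp122-large-field-II/…-p002∕p003∕p004-x2.png`, 2026-08-27); P. Federbush,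
*A phase cell approach to Yang–Mills theory. I*, Commun. Math. Phys. **107** (1986) 319–329 [Federbush1986PhaseCellI], p. 321
'Abelian Stability Theorem' (0.12) «averaging decreases the action», (1.3)–(1.9) pp. 322–323; T. Bałaban, *Propagators and
renormalization transformations for lattice gauge theories. I*, Commun. Math. Phys. **95** (1984) 17–40 [Balaban1984PropagatorsI]
(= [10] of the paper): (1.18) p. 20 the linear average `Q_k` (typed `B5Block118.QvOp`), (1.2) p. 18 / (1.21) p. 21 the plaquette
field and the action, (1.65)–(1.67) p. 29.

Cell pub-ymgap, HUMAN RULING D-0062 (Track A full width) ∕ D-0149 (width seats), seat `pub-ymgap-dag-n12-w4` (WIDTH SEAT 4 of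
DAG node N12 = [B15]; plan g77 `W-SEAT-START-LIST` §N12 item 4 = U2c «the comparison with `B5Bounds167Lattice.formDk` ([10]
(1.65)–(1.67)) with O(ε_k) error = [LF-II] (1.7) p. 358 itself»; key K1⁷ stmt-QuantumFields-20542, helper, count-neutral).

THE PRINT (p. 357 foot – p. 358 top, verbatim): *«Then we expand the expressions defining the quadratic form with respect to
A₀, up to the first order in A₀.  This was discussed in Sect. B [13].  The leading term in the expansion is the quadratic form
with the background field identically equal to 1.  Replacing the minimizer in this form by the kᵗʰ minimizer defined on the
whole lattice, and the function ζ₀ by the function identically equal to 1, we change the form by a quadratic form bounded by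
O(exp(−R_k)).  Now the leading quadratic form is equal to ⟨B′, Δ_kB′⟩ defined by (1.65), (1.66) [10].  Using the bound (1.67)
[10] for this form, we obtain ⟨H_{1,k}B′, Δ₁(ζ₀)H_{1,k}B′⟩ ≧ γ₀‖∂B′‖² − O(1)(M⁶R_kε_k + exp(−R_k))‖B′‖². (1.7)»*; p. 357
(1.6): *«By the exponential decay of the minimizer, and the localizations of 1 − ζ₀ and B′, …»* (`1 − ζ₀` lives far from `Λ`).
In the tree the (1.7) row is r13's `B16Ineq17Assembly.ineq17_of_inputs` (p308115) with THREE located letters: (a) the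
identification of the leading form with `⟨B′, Δ_kB′⟩`, (b) the first-order error `|E_A| ≤ C₁M⁶R_kε_k‖B′‖²`, (c) the
replacement error `|E_R| ≤ C₂e^{−R_k}‖B′‖²`; p26's `B16Ineq17BoxTorus.ineq17_chart_lattice` feeds it on the box chart from
(1.67) on the torus modulo ONE combined perturbation letter `hpert` ((a)+(b)+(c) against `formDk`).

THE OBSERVATION TYPED HERE.  For the LOWER bound (1.7) the detour (a)+(c)+(1.65)–(1.67) is unnecessary.  The leading term
*«the quadratic form with the background field identically equal to 1»* is, per 𝔤-coordinate, `Σ_p ζ₀(p)·|F^η(A)(p)|²`, the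
`ζ₀`-weighted flat fine action of the fine field `A = H⁰_{1,k}B′` (the flat linearised minimiser ON `Z`, any gauge), and ALL that
is used of `A` is that its block averages reproduce `B′` on the unit-lattice plaquettes near `Λ` (the linearised constraint of
the `Z`-problem (1.3)); then Federbush's abelian stability, LOCALIZED to those plaquettes and WEIGHTED by any `ζ ≥ 0` that is
`≥ 1` on their 2-block stencils (print: `ζ₀ ≡ 1` near `Λ`), gives `‖∂₁B′‖² ≤ ⟨A, Δ₁^{U₀=1}(ζ₀)A⟩_η` EXACTLY — `γ₀ = 1`, no
minimality, no decay, no replacement of the minimiser or of `ζ₀`, no momentum representation.  Consequently (1.7) holds in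
the form `Ineq17 Q ‖∂B′‖² ‖B′‖² 1 C M R_k ε_k` as soon as `Q = Q^{flat} + E_A` with located letter (b) ALONE.  (The tree's
GLOBAL unweighted Federbush theorem is `B5AverageCurlStokes.sum_normSq_plaq_QvOp_le`, p185634: `S = univ`, `ζ ≡ 1`; and
(1.65) = (1.66) IS certified — `B5Hk163Form166.DelK_form_eq_formDk`, `formDk_le_of_QvOp_eq` — so r02's `formDk` of the N12
chain's `hlead` letter IS the variational form `n^{−d}·min{½‖F^η(A)‖² : Q_kA = B}`; the present file is the route that does not
go through it.)

WHAT THIS FILE PROVES (kernel-checked, THEOREMS ONLY — no `def`, no new `… : Prop`, no `sorry`; axioms standard; BY NAME: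
`B5AverageCurlStokes.plaq_QvOp` ∕ `normSq_tripleSum_le` ∕ `sum_blocks_real` ∕ `sum_translate` ∕ `sum_comm_22` (p185634),
`Beta.FluctuationProjection.bpt_add_tstep_of_lt ∕ _of_le` (β sub-cell digit lemmas), `B5Blocks16.blockOf_bpt`,
`B16Ineq17BoxTorus.curl_apply` ∕ `torExt_of_forall_ne` ∕ `toTor_add_unitVec` ∕ `boxPlaq_vec_le_sum_d1Sq` (p26), `B16Sect1Wilson.Ineq17` ∕
`Ineq19` and `B16Ineq19BoxChart.ineq19_chart_of_17` (r13 ∕ p30), r02's `B5Bounds167Lattice.d1Sq`).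
§1 LOCALIZED WEIGHTED FEDERBUSH for the typed `Q_k` (every `d`, block side `n ≥ 1`, torus `Π_μ ℤ/Mt_μ`, complex fields):
   `normSq_plaq_QvOp_le_stencil` (Jensen on the `n^{d+2}`-term stencil of ONE coarse plaquette),
   ★ `sum_normSq_plaq_QvOp_le_weighted`: `n^d·Σ_{y∈S}‖plaq(Q_kA)_{μν}(y)‖² ≤ n²·Σ_x w(x)‖plaq A_{μν}(x)‖²` for `w ≥ 0`, `w ≥ 1`
   on the stencil `{n·y + j + s e_μ + t e_ν : y ∈ S, j ∈ [0,n)^d, s,t ∈ [0,n)}`; `sum_normSq_Fs_QvOp_le_weighted` (B5 units: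
   `Σ_{y∈S}‖F¹(Q_kA)‖² ≤ η^d Σ_x w‖F^η(A)‖²`); `sum_normSq_Fs_le_weighted_of_plaq_eq` (the coarse datum `B` matched with `Q_kA`
   ONLY on the plaquettes of `S`); (private `exists_bpt_add_tstep`), ★ `blockOf_stencil_mem` (the stencil of the plaquette at `y` lies in the
   four blocks `B(y), B(y+e_μ), B(y+e_ν), B(y+e_μ+e_ν)`), `sum_normSq_Fs_le_weighted_of_blocks` (weights read on BLOCKS: `w ≥ 1` on
   the blocks of a set `T` containing the four corners of every plaquette of `S`).
§2 `curl_eq_plaq`, `d1Sq_eq_half_sum_Fs` (r02's `⟨∂₁B,∂₁B⟩` in p185634's plaquette currency), ★★ `d1Sq_le_weighted_of_plaq_eq`: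
   `⟨∂₁B,∂₁B⟩ ≤ η^d·½Σ_{μ,ν}Σ_x ζ_{μν}(x)‖F^η_{μν}(A)(x)‖²` whenever `∂₁B` vanishes off `S`, the averages of `A` match `B` on `S`
   and `ζ ≥ 1` on the stencils of `S` (`ζ ≥ 0`; planes `μ ≠ ν` only); ★★ `d1Sq_le_weighted_of_blocks` (block form);
   `d1Sq_QvOp_le` (the global unweighted case in `d1Sq` currency: Federbush's theorem as «(1.67) lower half with γ₀ = 1»).
§3 (1.7) AT FLAT BACKGROUND, `γ₀ = 1`: `ineq17_flat_of_le` (the two-line bookkeeping: `Q = Q^{flat} + E_A`, `‖∂B′‖² ≤ Q^{flat}`,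
   `|E_A| ≤ C·M⁶R_kε_k·‖B′‖²` ⇒ `Ineq17 Q ‖∂B′‖² ‖B′‖² 1 C M R_k ε_k`), ★★ `ineq17_flat_lattice` (torus, `‖∂B′‖² = d1Sq Mt B′`,
   block-form weights).
§4 ON THE BOX CHART of p26 (`Λ = box nb y ⊂ T`, `B̃′ = torExt` of the chart point, `‖B′‖² = sqN x`): `plaq_torExt_eq_zero_of_not_mem`
   (`∂₁B̃′` lives on the image `S₀` of the enlarged box `box (nb+1) (y−1)`), `ineq17_chart_of_sum_d1Sq_le`, ★★ `ineq17_chart_flat`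
   (one fine field per 𝔤-coordinate matched with `B̃′` on `S₀`, weights `≥ 1` on the blocks around `S₀`) — p26's
   `ineq17_chart_lattice` with `hpert` REPLACED by the flat-form domination + letter (b), `γ₀ = (4/π²)^{d+2}` replaced by `1`;
   `ineq19_chart_of_sum_d1Sq_le` ((1.9) on the chart by `ineq19_chart_of_17` with `γ₀ = 1`: smallness
   `C(M⁶R_kε_k + e^{−R_k}) ≤ 1/(2d(100M)^{d+1})`).
§5 THE `n′ = 1` READING: ★ `sum_formDk_one_sub_le`, `sum_formDk_one_torExt_sub_le` — since `formDk 1 Mt = d1Sq Mt` (β sub-cell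
   `Beta.MonotoneScales.formDk_one`), the flat route delivers the LOWER HALF of the N12∕s1 letter `hlead` ∕ of p26's `hpert` at step
   `n′ := 1` (`Σ_a formDk 1 Mt (B_a) − C_err‖B′‖² ≤ Q`) — the only half their consumers use; the two-sided letters stay print's route.

HONEST SCOPE (located, nothing of Bałaban's asserted).  (i) Finite algebra about the TYPED LINEAR average of B5 (1.18) on complex
vector fields over the typed tori of `B5Prop11Plancherel` (the `U = 1` ∕ 𝔤-valued layer): Jensen + block bijection + translation
invariance, with supports and weights tracked.  (ii) NOT here, and displayed as hypotheses where used: the identification of the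
second variation `Δ₁(ζ₀)` of the `ζ₀`-weighted Wilson action AT BACKGROUND `1` with the `ζ₀`-weighted flat fine action (U2a of
the cell's N12 list), the identification of NODE 00's linearised averaging at flat background with `QvOp` and the constraint
`Q_k(H⁰_{1,k}B′) = B′` near `Λ` (U2b), the first-order `A₀`-expansion letter (b) (Sect. F [15] ∕ Sect. B [13]) — these are the
N12 lanes' objects.  (iii) The N12∕s1 chain's letter `hlead` (`B15Prop1Thm1GeneralFormShapes` §4, two-sided closeness to `formDk`)
is print's route and is NOT implied by this file; what this file feeds is the `(1.7)`-SHAPED letter (`Ineq17`, resp. the `h17` of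
p480805 `B15Prop1CarrierOnSU2BoxExt193.prop1Printed_lfVarOn_su2_box_G0_of_17_ext193`) with `γ₀ = 1`.  (iv) `d`, `D`, `n ≥ 1`, the
torus and the box arbitrary; B5's unweighted `ℓ²` conventions as in p185634 ∕ r02.  Count-neutral; N12 NOT discharged; one finite
𝕋⁴ programme at fixed `ε`; R4 closes the conditional rung `BalabanLadder.UV` only; nothing continuum ∕ ℝ⁴ ∕ OS ∕ mass gap ∕ Clay.
-/

noncomputable section

open scoped BigOperators Matrix
open Finset Complex

namespace Literature.MathematicalPhysics.QuantumFieldTheory.Balaban1983to89.B16Ineq17LocalFederbush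

open B5Prop11Plancherel (Tor fine unitVec)
open B5Action121 (Fs Fs_apply)
open B5Block118 (tstep bpt QvOp)
open B5Blocks16 (blockOf_bpt)
open Beta.FluctuationProjection (bpt_add_tstep_of_lt bpt_add_tstep_of_le)
open B5AverageCurlStokes (plaq plaq_apply plaq_QvOp squareSum normSq_tripleSum_le sum_blocks_real sum_translate sum_comm_22
  Fs_eq_mul_plaq)
open B16Sect1Wilson (Ineq17 Ineq19)
open B16Ineq111Gaussian (sqN sqN_nonneg)
open B16Eq18Proof (box innerPlaq)
open B16Ineq19BoxChart (chartSet ext ineq19_chart_of_17)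
open B16Ineq17BoxTorus (toTor torExt boxPlaq_vec_le_sum_d1Sq)

/-! ## §1  Localized, weighted Federbush abelian stability for the typed `Q_k` -/

section Local

variable {d : ℕ} (n : ℕ) [NeZero n] (Mt : Fin d → ℕ) [hMt : ∀ μ, NeZero (Mt μ)]

/-- **One coarse plaquette, Jensen on its stencil**: for Bałaban's linear average `Q_k` (B5 (1.18), typed `QvOp`) the unit-lattice
plaquette variable at `y` in the `(μ, ν)` plane is `η^{d+1}` times the sum of the `n^{d+2}` fine plaquette variables of the
stencil `{n·y + j + s e_μ + t e_ν}` (`B5AverageCurlStokes.plaq_QvOp`, Federbush I (1.3)–(1.4)), hence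
`‖plaq(Q_kA)_{μν}(y)‖² ≤ η^d · Σ_{j,s,t} ‖plaq A_{μν}(n·y + j + s e_μ + t e_ν)‖²`.
[cite: Federbush1986PhaseCellI, (1.3)–(1.4) p.322, (1.5)–(1.9) p.323; Balaban1984PropagatorsI, (1.18) p.20] -/
theorem normSq_plaq_QvOp_le_stencil (A : Tor (fine n Mt) × Fin d → ℂ) (μ ν : Fin d) (y : Tor Mt) :
    ‖plaq Mt (QvOp n Mt *ᵥ A) μ ν y‖ ^ 2
      ≤ 1 / (n : ℝ) ^ d * ∑ j : Fin d → Fin n, ∑ s : Fin n, ∑ t : Fin n,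
          ‖plaq (fine n Mt) A μ ν (bpt n Mt y j + tstep (fine n Mt) μ s + tstep (fine n Mt) ν t)‖ ^ 2 := by
  have hn : (0 : ℝ) < n := by exact_mod_cast Nat.pos_of_ne_zero (NeZero.ne n)
  rw [plaq_QvOp, norm_mul, mul_pow]
  have hc : ‖(1 : ℂ) / (n : ℂ) ^ (d + 1)‖ = 1 / (n : ℝ) ^ (d + 1) := by
    rw [norm_div, norm_one, norm_pow, Complex.norm_natCast]
  rw [hc]
  have key : ‖∑ j : Fin d → Fin n, squareSum n Mt A μ ν (bpt n Mt y j)‖ ^ 2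
      ≤ (n : ℝ) ^ (d + 2) * ∑ j : Fin d → Fin n, ∑ s : Fin n, ∑ t : Fin n,
          ‖plaq (fine n Mt) A μ ν (bpt n Mt y j + tstep (fine n Mt) μ s + tstep (fine n Mt) ν t)‖ ^ 2 := by
    simp only [squareSum]
    exact normSq_tripleSum_le n (fun j s t =>
      plaq (fine n Mt) A μ ν (bpt n Mt y j + tstep (fine n Mt) μ s + tstep (fine n Mt) ν t))
  have hsc : (1 / (n : ℝ) ^ (d + 1)) ^ 2 * (n : ℝ) ^ (d + 2) = 1 / (n : ℝ) ^ d := by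
    rw [div_pow, one_pow, div_mul_eq_mul_div, one_mul, div_eq_div_iff (by positivity) (by positivity), one_mul, ← pow_mul,
      ← pow_add]
    congr 1
    ring
  calc (1 / (n : ℝ) ^ (d + 1)) ^ 2 * ‖∑ j : Fin d → Fin n, squareSum n Mt A μ ν (bpt n Mt y j)‖ ^ 2
      ≤ (1 / (n : ℝ) ^ (d + 1)) ^ 2 * ((n : ℝ) ^ (d + 2) * ∑ j : Fin d → Fin n, ∑ s : Fin n, ∑ t : Fin n,
          ‖plaq (fine n Mt) A μ ν (bpt n Mt y j + tstep (fine n Mt) μ s + tstep (fine n Mt) ν t)‖ ^ 2) :=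
        mul_le_mul_of_nonneg_left key (by positivity)
    _ = 1 / (n : ℝ) ^ d * ∑ j : Fin d → Fin n, ∑ s : Fin n, ∑ t : Fin n,
          ‖plaq (fine n Mt) A μ ν (bpt n Mt y j + tstep (fine n Mt) μ s + tstep (fine n Mt) ν t)‖ ^ 2 := by
        rw [← mul_assoc, hsc]

/-- ★ **LOCALIZED, WEIGHTED FEDERBUSH STABILITY FOR THE TYPED `Q_k`** (per coordinate plane, every `d`, every block side `n ≥ 1`,
every torus, every complex vector field): for every finite set `S` of unit-lattice plaquettes (base points `y`) and every fine
weight `w ≥ 0` with `w ≥ 1` on the stencils of `S`,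
`n^d · Σ_{y∈S} ‖plaq(Q_kA)_{μν}(y)‖² ≤ n² · Σ_x w(x)‖plaq A_{μν}(x)‖²` — Federbush's «averaging decreases the action» with the
supports of both sides tracked (each fine plaquette is met by at most `n²` (base point, offset) pairs, and only stencil plaquettes,
where `w ≥ 1`, are met at all).  At `S = univ`, `w ≡ 1` this is `B5AverageCurlStokes.sum_normSq_plaq_QvOp_le`.
[cite: Federbush1986PhaseCellI, 'Abelian Stability Theorem' (0.12) p.321, (1.3)–(1.9) pp.322–323; BalabanImbrieJaffe1985, (2.13) p.304, p.309;
Balaban1984PropagatorsI, (1.18) p.20] -/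
theorem sum_normSq_plaq_QvOp_le_weighted (A : Tor (fine n Mt) × Fin d → ℂ) (μ ν : Fin d) (S : Finset (Tor Mt))
    (w : Tor (fine n Mt) → ℝ) (hw0 : ∀ x, 0 ≤ w x)
    (hw1 : ∀ y ∈ S, ∀ (j : Fin d → Fin n) (s t : Fin n), 1 ≤ w (bpt n Mt y j + tstep (fine n Mt) μ s + tstep (fine n Mt) ν t)) :
    (n : ℝ) ^ d * ∑ y ∈ S, ‖plaq Mt (QvOp n Mt *ᵥ A) μ ν y‖ ^ 2
      ≤ (n : ℝ) ^ 2 * ∑ x, w x * ‖plaq (fine n Mt) A μ ν x‖ ^ 2 := by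
  have hn : (0 : ℝ) < n := by exact_mod_cast Nat.pos_of_ne_zero (NeZero.ne n)
  -- the weighted fine density
  set g : Tor (fine n Mt) → ℝ := fun x => w x * ‖plaq (fine n Mt) A μ ν x‖ ^ 2 with hg
  have hg0 : ∀ x, 0 ≤ g x := fun x => mul_nonneg (hw0 x) (by positivity)
  -- pointwise on `S`: Jensen on the stencil, then `1 ≤ w` there
  have hpt : ∀ y ∈ S, (n : ℝ) ^ d * ‖plaq Mt (QvOp n Mt *ᵥ A) μ ν y‖ ^ 2
      ≤ ∑ j : Fin d → Fin n, ∑ s : Fin n, ∑ t : Fin n, g (bpt n Mt y j + tstep (fine n Mt) μ s + tstep (fine n Mt) ν t) := by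
    intro y hy
    have h1 := normSq_plaq_QvOp_le_stencil n Mt A μ ν y
    have h2 : ∑ j : Fin d → Fin n, ∑ s : Fin n, ∑ t : Fin n,
          ‖plaq (fine n Mt) A μ ν (bpt n Mt y j + tstep (fine n Mt) μ s + tstep (fine n Mt) ν t)‖ ^ 2
        ≤ ∑ j : Fin d → Fin n, ∑ s : Fin n, ∑ t : Fin n, g (bpt n Mt y j + tstep (fine n Mt) μ s + tstep (fine n Mt) ν t) := by
      refine Finset.sum_le_sum fun j _ => Finset.sum_le_sum fun s _ => Finset.sum_le_sum fun t _ => ?_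
      simp only [hg]
      exact le_mul_of_one_le_left (by positivity) (hw1 y hy j s t)
    calc (n : ℝ) ^ d * ‖plaq Mt (QvOp n Mt *ᵥ A) μ ν y‖ ^ 2
        ≤ (n : ℝ) ^ d * (1 / (n : ℝ) ^ d * ∑ j : Fin d → Fin n, ∑ s : Fin n, ∑ t : Fin n,
            ‖plaq (fine n Mt) A μ ν (bpt n Mt y j + tstep (fine n Mt) μ s + tstep (fine n Mt) ν t)‖ ^ 2) :=
          mul_le_mul_of_nonneg_left h1 (by positivity)
      _ = ∑ j : Fin d → Fin n, ∑ s : Fin n, ∑ t : Fin n,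
            ‖plaq (fine n Mt) A μ ν (bpt n Mt y j + tstep (fine n Mt) μ s + tstep (fine n Mt) ν t)‖ ^ 2 := by
          rw [← mul_assoc, mul_one_div_cancel (by positivity), one_mul]
      _ ≤ _ := h2
  -- the full block-and-square sum of `g` is `n²` copies of the full torus sum (block bijection + translation invariance)
  have hre : ∑ y : Tor Mt, ∑ j : Fin d → Fin n, ∑ s : Fin n, ∑ t : Fin n,
        g (bpt n Mt y j + tstep (fine n Mt) μ s + tstep (fine n Mt) ν t)
      = (n : ℝ) ^ 2 * ∑ x : Tor (fine n Mt), g x := by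
    rw [sum_comm_22 (fun (y : Tor Mt) (j : Fin d → Fin n) (s : Fin n) (t : Fin n) =>
        g (bpt n Mt y j + tstep (fine n Mt) μ s + tstep (fine n Mt) ν t))]
    have step2 : ∀ s t : Fin n, ∑ y : Tor Mt, ∑ j : Fin d → Fin n,
          g (bpt n Mt y j + tstep (fine n Mt) μ s + tstep (fine n Mt) ν t) = ∑ x : Tor (fine n Mt), g x := by
      intro s t
      rw [← sum_blocks_real n Mt (fun x => g (x + tstep (fine n Mt) μ s + tstep (fine n Mt) ν t))]
      simp_rw [add_assoc]
      exact sum_translate n Mt g _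
    simp_rw [step2]
    simp only [Finset.sum_const, Finset.card_univ, Fintype.card_fin, nsmul_eq_mul]
    ring
  calc (n : ℝ) ^ d * ∑ y ∈ S, ‖plaq Mt (QvOp n Mt *ᵥ A) μ ν y‖ ^ 2
      = ∑ y ∈ S, (n : ℝ) ^ d * ‖plaq Mt (QvOp n Mt *ᵥ A) μ ν y‖ ^ 2 := Finset.mul_sum _ _ _
    _ ≤ ∑ y ∈ S, ∑ j : Fin d → Fin n, ∑ s : Fin n, ∑ t : Fin n,
          g (bpt n Mt y j + tstep (fine n Mt) μ s + tstep (fine n Mt) ν t) := Finset.sum_le_sum hpt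
    _ ≤ ∑ y : Tor Mt, ∑ j : Fin d → Fin n, ∑ s : Fin n, ∑ t : Fin n,
          g (bpt n Mt y j + tstep (fine n Mt) μ s + tstep (fine n Mt) ν t) :=
        Finset.sum_le_sum_of_subset_of_nonneg (Finset.subset_univ S) fun y _ _ =>
          Finset.sum_nonneg fun j _ => Finset.sum_nonneg fun s _ => Finset.sum_nonneg fun t _ => hg0 _
    _ = (n : ℝ) ^ 2 * ∑ x : Tor (fine n Mt), g x := hre
    _ = (n : ℝ) ^ 2 * ∑ x, w x * ‖plaq (fine n Mt) A μ ν x‖ ^ 2 := by simp only [hg]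

/-- **The same in B5's normalisation** (`F = Fs` of (1.2) with lattice factor `c = 1` on the unit lattice `T₁^{(k)}`, `c = n = η⁻¹`
on `T_η`, and the `η^d` site weight of (1.21)): `Σ_{y∈S} ‖F¹_{μν}(Q_kA)(y)‖² ≤ η^d · Σ_x w(x)‖F^η_{μν}(A)(x)‖²` — a WEIGHTED,
LOCALIZED «averaging decreases the action», constant exactly `1`. [cite: Federbush1986PhaseCellI, 'Abelian Stability Theorem' (0.12) p.321;
Balaban1984PropagatorsI, (1.2) p.18, (1.18) p.20, (1.21) p.21] -/
theorem sum_normSq_Fs_QvOp_le_weighted (A : Tor (fine n Mt) × Fin d → ℂ) (μ ν : Fin d) (S : Finset (Tor Mt))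
    (w : Tor (fine n Mt) → ℝ) (hw0 : ∀ x, 0 ≤ w x)
    (hw1 : ∀ y ∈ S, ∀ (j : Fin d → Fin n) (s t : Fin n), 1 ≤ w (bpt n Mt y j + tstep (fine n Mt) μ s + tstep (fine n Mt) ν t)) :
    ∑ y ∈ S, ‖Fs Mt 1 (QvOp n Mt *ᵥ A) μ ν y‖ ^ 2
      ≤ 1 / (n : ℝ) ^ d * ∑ x, w x * ‖Fs (fine n Mt) (n : ℂ) A μ ν x‖ ^ 2 := by
  have hn : (0 : ℝ) < n := by exact_mod_cast Nat.pos_of_ne_zero (NeZero.ne n)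
  have h := sum_normSq_plaq_QvOp_le_weighted n Mt A μ ν S w hw0 hw1
  simp_rw [Fs_eq_mul_plaq, one_mul, norm_mul, Complex.norm_natCast, mul_pow]
  have hdist : ∑ x, w x * ((n : ℝ) ^ 2 * ‖plaq (fine n Mt) A μ ν x‖ ^ 2)
      = (n : ℝ) ^ 2 * ∑ x, w x * ‖plaq (fine n Mt) A μ ν x‖ ^ 2 := by
    rw [Finset.mul_sum]
    exact Finset.sum_congr rfl fun x _ => by ring
  rw [hdist, ← mul_assoc, show 1 / (n : ℝ) ^ d * (n : ℝ) ^ 2 = (n : ℝ) ^ 2 / (n : ℝ) ^ d by ring, div_mul_eq_mul_div,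
    le_div_iff₀ (by positivity), mul_comm]
  exact h

/-- **Fibre ∕ local-constraint form**: if the unit-lattice field `B` has the same plaquette variables as `Q_kA` ON THE PLAQUETTES OF
`S` (the block averages of `A` reproduce `B` there — e.g. `A` = the flat linearised minimiser of the `Z`-problem, whose
constraint [Balaban1989LargeFieldII] (1.3)–(1.4) fixes the averages on `B_k(Z)`), then
`Σ_{y∈S} ‖F¹_{μν}(B)(y)‖² ≤ η^d · Σ_x w(x)‖F^η_{μν}(A)(x)‖²`.  No minimality, no decay and no gauge condition on `A` is used.
[cite: Federbush1986PhaseCellI, 'Abelian Stability Theorem' (0.12) p.321; Balaban1989LargeFieldII, (1.3)–(1.4) p.357;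
BalabanImbrieJaffe1985, (4.1.5) p.310] -/
theorem sum_normSq_Fs_le_weighted_of_plaq_eq (A : Tor (fine n Mt) × Fin d → ℂ) (B : Tor Mt × Fin d → ℂ) (μ ν : Fin d)
    (S : Finset (Tor Mt)) (hB : ∀ y ∈ S, plaq Mt B μ ν y = plaq Mt (QvOp n Mt *ᵥ A) μ ν y)
    (w : Tor (fine n Mt) → ℝ) (hw0 : ∀ x, 0 ≤ w x)
    (hw1 : ∀ y ∈ S, ∀ (j : Fin d → Fin n) (s t : Fin n), 1 ≤ w (bpt n Mt y j + tstep (fine n Mt) μ s + tstep (fine n Mt) ν t)) :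
    ∑ y ∈ S, ‖Fs Mt 1 B μ ν y‖ ^ 2
      ≤ 1 / (n : ℝ) ^ d * ∑ x, w x * ‖Fs (fine n Mt) (n : ℂ) A μ ν x‖ ^ 2 := by
  calc ∑ y ∈ S, ‖Fs Mt 1 B μ ν y‖ ^ 2 = ∑ y ∈ S, ‖Fs Mt 1 (QvOp n Mt *ᵥ A) μ ν y‖ ^ 2 := by
        refine Finset.sum_congr rfl fun y hy => ?_
        rw [Fs_eq_mul_plaq, Fs_eq_mul_plaq, hB y hy]
    _ ≤ 1 / (n : ℝ) ^ d * ∑ x, w x * ‖Fs (fine n Mt) (n : ℂ) A μ ν x‖ ^ 2 :=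
        sum_normSq_Fs_QvOp_le_weighted n Mt A μ ν S w hw0 hw1

/-! ### The stencil of a coarse plaquette lies in four blocks -/

omit [NeZero n] hMt in
/-- One fine step along a block line stays in the block or enters the next one: `(n·y + j) + s e_μ = n·y′ + j′` with
`y′ ∈ {y, y + e_μ}` (`s < n`) — the β sub-cell's digit lemmas `Beta.FluctuationProjection.bpt_add_tstep_of_lt ∕ _of_le` BY NAME.
[folklore] -/
private theorem exists_bpt_add_tstep (y : Tor Mt) (j : Fin d → Fin n) (μ : Fin d) (s : Fin n) :
    ∃ j' : Fin d → Fin n, bpt n Mt y j + tstep (fine n Mt) μ s = bpt n Mt y j'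
      ∨ bpt n Mt y j + tstep (fine n Mt) μ s = bpt n Mt (y + unitVec Mt μ) j' := by
  by_cases h : (j μ : ℕ) + s < n
  · exact ⟨_, Or.inl (bpt_add_tstep_of_lt n Mt y j μ s h)⟩
  · exact ⟨_, Or.inr (bpt_add_tstep_of_le n Mt y j μ s (not_lt.mp h) (by have := (j μ).is_lt; have := s.is_lt; omega))⟩

/-- **THE STENCIL OF A COARSE PLAQUETTE LIES IN FOUR BLOCKS**: every fine site `n·y + j + s e_μ + t e_ν` (`j ∈ [0,n)^d`,
`s, t < n`) of the stencil of the unit plaquette at `y` in the `(μ, ν)` plane lies in one of the blocks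
`B(y), B(y + e_μ), B(y + e_ν), B(y + e_μ + e_ν)` (B5 (1.6) «we divide T₁ into blocks B(y)», `B5Blocks16.blockOf`).
[cite: Balaban1984PropagatorsI, (1.6) p.18, (1.18) p.20] -/
theorem blockOf_stencil_mem (y : Tor Mt) (j : Fin d → Fin n) (μ ν : Fin d) (s t : Fin n) :
    B5Blocks16.blockOf n Mt (bpt n Mt y j + tstep (fine n Mt) μ s + tstep (fine n Mt) ν t)
      ∈ ({y, y + unitVec Mt μ, y + unitVec Mt ν, y + unitVec Mt μ + unitVec Mt ν} : Finset (Tor Mt)) := by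
  simp only [Finset.mem_insert, Finset.mem_singleton]
  obtain ⟨j₁, h₁ | h₁⟩ := exists_bpt_add_tstep n Mt y j μ s
  · rw [h₁]
    obtain ⟨j₂, h₂ | h₂⟩ := exists_bpt_add_tstep n Mt y j₁ ν t
    · rw [h₂, blockOf_bpt]; exact Or.inl rfl
    · rw [h₂, blockOf_bpt]; exact Or.inr (Or.inr (Or.inl rfl))
  · rw [h₁]
    obtain ⟨j₂, h₂ | h₂⟩ := exists_bpt_add_tstep n Mt (y + unitVec Mt μ) j₁ ν t
    · rw [h₂, blockOf_bpt]; exact Or.inr (Or.inl rfl)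
    · rw [h₂, blockOf_bpt]; exact Or.inr (Or.inr (Or.inr rfl))

/-- **Block form of the weights**: if `w ≥ 1` on every fine site whose block lies in a set `T` of unit-lattice sites containing,
for each plaquette `y ∈ S`, the four corners `y, y + e_μ, y + e_ν, y + e_μ + e_ν` (print: `ζ₀ ≡ 1` on the blocks near `Λ`), then
`w ≥ 1` on the stencils of `S`, and §1's localized Federbush inequality reads
`Σ_{y∈S} ‖F¹_{μν}(B)(y)‖² ≤ η^d · Σ_x w(x)‖F^η_{μν}(A)(x)‖²` for every `B` matched with `Q_kA` on `S`.
[cite: Federbush1986PhaseCellI, 'Abelian Stability Theorem' (0.12) p.321; Balaban1984PropagatorsI, (1.6) p.18, (1.18) p.20] -/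
theorem sum_normSq_Fs_le_weighted_of_blocks (A : Tor (fine n Mt) × Fin d → ℂ) (B : Tor Mt × Fin d → ℂ) (μ ν : Fin d)
    (S T : Finset (Tor Mt)) (hB : ∀ y ∈ S, plaq Mt B μ ν y = plaq Mt (QvOp n Mt *ᵥ A) μ ν y)
    (hT : ∀ y ∈ S, y ∈ T ∧ y + unitVec Mt μ ∈ T ∧ y + unitVec Mt ν ∈ T ∧ y + unitVec Mt μ + unitVec Mt ν ∈ T)
    (w : Tor (fine n Mt) → ℝ) (hw0 : ∀ x, 0 ≤ w x) (hwT : ∀ x, B5Blocks16.blockOf n Mt x ∈ T → 1 ≤ w x) :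
    ∑ y ∈ S, ‖Fs Mt 1 B μ ν y‖ ^ 2
      ≤ 1 / (n : ℝ) ^ d * ∑ x, w x * ‖Fs (fine n Mt) (n : ℂ) A μ ν x‖ ^ 2 := by
  refine sum_normSq_Fs_le_weighted_of_plaq_eq n Mt A B μ ν S hB w hw0 fun y hy j s t => hwT _ ?_
  have h := blockOf_stencil_mem n Mt y j μ ν s t
  simp only [Finset.mem_insert, Finset.mem_singleton] at h
  obtain ⟨h1, h2, h3, h4⟩ := hT y hy
  rcases h with h | h | h | h <;> rw [h] <;> assumption

end Local

/-! ## §2  All planes: r02's `⟨∂₁B, ∂₁B⟩` dominated by the weighted flat fine action -/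

section AllPlanes

variable {d : ℕ} (n : ℕ) [NeZero n] (Mt : Fin d → ℕ) [hMt : ∀ μ, NeZero (Mt μ)]

omit [NeZero n] in
/-- r02's `(∂₁B)_{μν}(x)` (`B5Bounds167Lattice.curl`, the (1.66) curl with unit forward differences) IS p185634's plaquette sum
`plaq` (both are `B_μ(x) + B_ν(x+e_μ) − B_μ(x+e_ν) − B_ν(x)`, cf. p26's `B16Ineq17BoxTorus.curl_apply`).
[cite: Balaban1984PropagatorsI, (1.2) p.18, (1.66) p.29] -/
theorem curl_eq_plaq (B : Tor Mt × Fin d → ℂ) (μ ν : Fin d) (y : Tor Mt) :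
    B5Bounds167Lattice.curl Mt B μ ν y = plaq Mt B μ ν y := by
  rw [B16Ineq17BoxTorus.curl_apply, plaq_apply]

omit [NeZero n] in
/-- r02's `⟨∂₁B, ∂₁B⟩ = ½Σ_{μ,ν}Σ_x|(∂₁B)_{μν}(x)|²` in the plaquette-field currency of (1.2) at unit spacing:
`d1Sq Mt B = ½Σ_{μ,ν}Σ_y ‖F¹_{μν}(B)(y)‖²`. [cite: Balaban1984PropagatorsI, (1.2) p.18, (1.21) p.21, (1.66) p.29] -/
theorem d1Sq_eq_half_sum_Fs (B : Tor Mt × Fin d → ℂ) :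
    B5Bounds167Lattice.d1Sq Mt B = 1 / 2 * ∑ μ, ∑ ν, ∑ y, ‖Fs Mt 1 B μ ν y‖ ^ 2 := by
  unfold B5Bounds167Lattice.d1Sq
  congr 1
  refine Finset.sum_congr rfl fun μ _ => Finset.sum_congr rfl fun ν _ => Finset.sum_congr rfl fun y _ => ?_
  rw [curl_eq_plaq, Fs_eq_mul_plaq, one_mul]

/-- ★★ **`⟨∂₁B, ∂₁B⟩ ≤ ⟨A, Δ₁^{flat}(ζ)A⟩_η` FOR EVERY FINE FIELD WHOSE BLOCK AVERAGES REPRODUCE `B` NEAR ITS CURL.**  Let `S` be a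
set of unit-lattice plaquette base points off which every `(∂₁B)_{μν}`, `μ ≠ ν`, vanishes (print: `B′` lives on `Λ`, zero
elsewhere), let the fine field `A` have the plaquette variables of its average `Q_kA` equal to those of `B` on `S` (the linearised
constraint of the `Z`-problem [Balaban1989LargeFieldII] (1.3)), and let the plane-indexed fine weights `ζ_{μν} ≥ 0` be `≥ 1` on
the stencils of `S` (print p. 357 (1.6): «the localizations of 1 − ζ₀ and B′» — `ζ₀ ≡ 1` near `Λ`).  Then
`d1Sq Mt B ≤ η^d · ½Σ_{μ,ν}Σ_x ζ_{μν}(x)‖F^η_{μν}(A)(x)‖²` — the `ζ`-weighted flat fine action of `A` in B5's units (1.21).  With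
`A = H⁰_{1,k}B′` this READS «the quadratic form with the background field identically equal to 1» `≥ ‖∂B′‖²`: the `γ₀` of (1.7)
is `1` and NEITHER replacement step of p. 357 («the kᵗʰ minimizer defined on the whole lattice», «ζ₀ by the function identically
equal to 1») NOR (1.65)–(1.67) [10] is needed for the lower bound.  (Only planes `μ ≠ ν` carry hypotheses: `F_{μμ} = 0`.)
[cite: Balaban1989LargeFieldII, (1.6)–(1.7) pp.357–358; Federbush1986PhaseCellI, 'Abelian Stability Theorem' (0.12) p.321;
Balaban1984PropagatorsI, (1.21) p.21, (1.67) p.29] -/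
theorem d1Sq_le_weighted_of_plaq_eq (A : Tor (fine n Mt) × Fin d → ℂ) (B : Tor Mt × Fin d → ℂ) (S : Finset (Tor Mt))
    (hS : ∀ μ ν, μ ≠ ν → ∀ y ∉ S, plaq Mt B μ ν y = 0)
    (hB : ∀ μ ν, μ ≠ ν → ∀ y ∈ S, plaq Mt B μ ν y = plaq Mt (QvOp n Mt *ᵥ A) μ ν y)
    (ζ : Fin d → Fin d → Tor (fine n Mt) → ℝ) (hζ0 : ∀ μ ν x, 0 ≤ ζ μ ν x)
    (hζ1 : ∀ μ ν, μ ≠ ν → ∀ y ∈ S, ∀ (j : Fin d → Fin n) (s t : Fin n),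
      1 ≤ ζ μ ν (bpt n Mt y j + tstep (fine n Mt) μ s + tstep (fine n Mt) ν t)) :
    B5Bounds167Lattice.d1Sq Mt B
      ≤ 1 / (n : ℝ) ^ d * (1 / 2 * ∑ μ, ∑ ν, ∑ x, ζ μ ν x * ‖Fs (fine n Mt) (n : ℂ) A μ ν x‖ ^ 2) := by
  -- per plane: the diagonal planes vanish; off the diagonal restrict the coarse sum to `S`, then §1
  have hplane : ∀ μ ν, ∑ y, ‖Fs Mt 1 B μ ν y‖ ^ 2
      ≤ 1 / (n : ℝ) ^ d * ∑ x, ζ μ ν x * ‖Fs (fine n Mt) (n : ℂ) A μ ν x‖ ^ 2 := by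
    intro μ ν
    by_cases hμν : μ = ν
    · subst hμν
      have h0 : ∑ y, ‖Fs Mt 1 B μ μ y‖ ^ 2 = 0 :=
        Finset.sum_eq_zero fun y _ => by rw [B5Action121.Fs_self, norm_zero]; simp
      rw [h0]
      exact mul_nonneg (by positivity) (Finset.sum_nonneg fun x _ => mul_nonneg (hζ0 μ μ x) (by positivity))
    have hrestrict : ∑ y ∈ S, ‖Fs Mt 1 B μ ν y‖ ^ 2 = ∑ y, ‖Fs Mt 1 B μ ν y‖ ^ 2 :=
      Finset.sum_subset (Finset.subset_univ S) fun y _ hy => by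
        rw [Fs_eq_mul_plaq, one_mul, hS μ ν hμν y hy, norm_zero]
        simp
    rw [← hrestrict]
    exact sum_normSq_Fs_le_weighted_of_plaq_eq n Mt A B μ ν S (hB μ ν hμν) (ζ μ ν) (hζ0 μ ν) (hζ1 μ ν hμν)
  rw [d1Sq_eq_half_sum_Fs]
  calc 1 / 2 * ∑ μ, ∑ ν, ∑ y, ‖Fs Mt 1 B μ ν y‖ ^ 2
      ≤ 1 / 2 * ∑ μ, ∑ ν, (1 / (n : ℝ) ^ d * ∑ x, ζ μ ν x * ‖Fs (fine n Mt) (n : ℂ) A μ ν x‖ ^ 2) := by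
        gcongr with μ _ ν _
        exact hplane μ ν
    _ = 1 / (n : ℝ) ^ d * (1 / 2 * ∑ μ, ∑ ν, ∑ x, ζ μ ν x * ‖Fs (fine n Mt) (n : ℂ) A μ ν x‖ ^ 2) := by
        rw [mul_left_comm]
        congr 1
        rw [Finset.mul_sum]
        refine Finset.sum_congr rfl fun μ _ => ?_
        rw [Finset.mul_sum]

/-- **Block form**: the same with the weight condition read on BLOCKS — `ζ_{μν} ≥ 1` on every fine site whose block lies in a set
`T` of unit-lattice sites containing the four corners `y, y + e_μ, y + e_ν, y + e_μ + e_ν` of every plaquette `y ∈ S` (by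
`blockOf_stencil_mem` the stencils of `S` lie in those blocks).  This is the form print's geometry supplies: `1 − ζ₀` is supported
on blocks far from `Λ` ((1.6)), so `ζ₀ ≡ 1` on the blocks of `T` = the 1-neighbourhood of the blocks meeting `Λ`.
[cite: Balaban1989LargeFieldII, (1.6)–(1.7) pp.357–358; Federbush1986PhaseCellI, 'Abelian Stability Theorem' (0.12) p.321;
Balaban1984PropagatorsI, (1.6) p.18] -/
theorem d1Sq_le_weighted_of_blocks (A : Tor (fine n Mt) × Fin d → ℂ) (B : Tor Mt × Fin d → ℂ) (S T : Finset (Tor Mt))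
    (hS : ∀ μ ν, μ ≠ ν → ∀ y ∉ S, plaq Mt B μ ν y = 0)
    (hB : ∀ μ ν, μ ≠ ν → ∀ y ∈ S, plaq Mt B μ ν y = plaq Mt (QvOp n Mt *ᵥ A) μ ν y)
    (hT : ∀ μ ν, μ ≠ ν → ∀ y ∈ S, y ∈ T ∧ y + unitVec Mt μ ∈ T ∧ y + unitVec Mt ν ∈ T ∧ y + unitVec Mt μ + unitVec Mt ν ∈ T)
    (ζ : Fin d → Fin d → Tor (fine n Mt) → ℝ) (hζ0 : ∀ μ ν x, 0 ≤ ζ μ ν x)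
    (hζT : ∀ μ ν x, B5Blocks16.blockOf n Mt x ∈ T → 1 ≤ ζ μ ν x) :
    B5Bounds167Lattice.d1Sq Mt B
      ≤ 1 / (n : ℝ) ^ d * (1 / 2 * ∑ μ, ∑ ν, ∑ x, ζ μ ν x * ‖Fs (fine n Mt) (n : ℂ) A μ ν x‖ ^ 2) := by
  refine d1Sq_le_weighted_of_plaq_eq n Mt A B S hS hB ζ hζ0 fun μ ν hμν y hy j s t => hζT μ ν _ ?_
  have h := blockOf_stencil_mem n Mt y j μ ν s t
  simp only [Finset.mem_insert, Finset.mem_singleton] at h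
  obtain ⟨h1, h2, h3, h4⟩ := hT μ ν hμν y hy
  rcases h with h | h | h | h <;> rw [h] <;> assumption

/-- **The global unweighted case in r02's currency**: `⟨∂₁(Q_kA), ∂₁(Q_kA)⟩ ≤ η^d·½Σ_{μ,ν}Σ_x‖F^η_{μν}(A)(x)‖²` for every fine
field `A` — Federbush's theorem for the typed `Q_k` read in `d1Sq` units (`S = univ`, `ζ ≡ 1`); with `A = H_kB` on the hyperplane
`Q_kA = B` it is the lower bound of (1.67) [10] with `γ₀ = 1` for the variational `Δ_k` of (1.65).
[cite: Federbush1986PhaseCellI, 'Abelian Stability Theorem' (0.12) p.321; Balaban1984PropagatorsI, (1.65)–(1.67) p.29] -/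
theorem d1Sq_QvOp_le (A : Tor (fine n Mt) × Fin d → ℂ) :
    B5Bounds167Lattice.d1Sq Mt (QvOp n Mt *ᵥ A)
      ≤ 1 / (n : ℝ) ^ d * (1 / 2 * ∑ μ : Fin d, ∑ ν : Fin d, ∑ x, ‖Fs (fine n Mt) (n : ℂ) A μ ν x‖ ^ 2) := by
  have h := d1Sq_le_weighted_of_plaq_eq n Mt A (QvOp n Mt *ᵥ A) Finset.univ
    (fun μ ν _ y hy => absurd (Finset.mem_univ y) hy) (fun μ ν _ y _ => rfl) (fun _ _ _ => (1 : ℝ))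
    (fun _ _ _ => zero_le_one) (fun _ _ _ _ _ _ _ _ => le_rfl)
  simpa only [one_mul] using h

end AllPlanes

/-! ## §3  (1.7) at flat background with `γ₀ = 1` -/

section Flat

/-- **THE BOOKKEEPING OF (1.7) AT FLAT BACKGROUND**: if the quadratic form splits as `Q = Q^{flat} + E_A` — the leading term *«with
the background field identically equal to 1»* plus the first-order error of the expansion in `A₀` (*«|A₀|, |∇^ηA₀| < O(1)M⁶R_kε_k …
Sect. B [13]»*, located letter (b) of r13's `B16Ineq17Assembly`: `|E_A| ≤ C·M⁶R_kε_k·‖B′‖²`) — and the flat form dominates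
`‖∂B′‖²` (§2), then `Ineq17 Q ‖∂B′‖² ‖B′‖² 1 C M R_k ε_k`: (1.7) with `γ₀ = 1` and the printed correction
`O(1)(M⁶R_kε_k + e^{−R_k})‖B′‖²` (its `e^{−R_k}` part is simply not used). [cite: Balaban1989LargeFieldII, (1.7) pp.357–358] -/
theorem ineq17_flat_of_le {Q Qflat EA ndB nB C M Rk εk : ℝ} (hQ : Q = Qflat + EA) (hlead : ndB ≤ Qflat)
    (hEA : |EA| ≤ C * (M ^ 6 * Rk * εk) * nB) (hC : 0 ≤ C) (hnB : 0 ≤ nB) :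
    Ineq17 Q ndB nB 1 C M Rk εk := by
  unfold Ineq17
  have h1 : -(C * (M ^ 6 * Rk * εk) * nB) ≤ EA := (abs_le.mp hEA).1
  have h2 : 0 ≤ C * Real.exp (-Rk) * nB := mul_nonneg (mul_nonneg hC (Real.exp_pos _).le) hnB
  have h3 : C * (M ^ 6 * Rk * εk + Real.exp (-Rk)) * nB = C * (M ^ 6 * Rk * εk) * nB + C * Real.exp (-Rk) * nB := by ring
  rw [h3, hQ]
  linarith

variable {d : ℕ} (n : ℕ) [NeZero n] (Mt : Fin d → ℕ) [hMt : ∀ μ, NeZero (Mt μ)]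

/-- ★★ **(1.7) AT FLAT BACKGROUND ON THE TORUS, `γ₀ = 1`, LETTER (b) ONLY.**  For a unit-lattice field `B′` on the torus
`T = Π_μ ℤ/Mt_μ` whose curl lives on the plaquettes of `S`, a fine field `A` on `T_η` (`η = 1/n`) whose block averages reproduce
`B′` on `S` (e.g. the flat linearised minimiser of the `Z`-problem), plane weights `ζ ≥ 0` that are `≥ 1` on the blocks of a set
`T` containing the four corners of every plaquette of `S` (`ζ₀ ≡ 1` near `Λ`), and a form `Q = Q^{flat} + E_A` with
`Q^{flat} ≥ η^d·½Σ_{μ,ν}Σ_x ζ_{μν}(x)‖F^η_{μν}(A)(x)‖²` (the leading flat term — U2a's identification displayed as `hflat`) and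
`|E_A| ≤ C·M⁶R_kε_k·‖B′‖²`: `Ineq17 Q (d1Sq Mt B′) ‖B′‖² 1 C M R_k ε_k`.  Neither «replacing the minimizer … by the kᵗʰ
minimizer defined on the whole lattice» nor «ζ₀ by the function identically equal to 1» nor (1.65)–(1.67) [10] enters.
[cite: Balaban1989LargeFieldII, (1.6)–(1.7) pp.357–358; Federbush1986PhaseCellI, 'Abelian Stability Theorem' (0.12) p.321] -/
theorem ineq17_flat_lattice (A : Tor (fine n Mt) × Fin d → ℂ) (B : Tor Mt × Fin d → ℂ) (S T : Finset (Tor Mt))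
    (hS : ∀ μ ν, μ ≠ ν → ∀ y ∉ S, plaq Mt B μ ν y = 0)
    (hB : ∀ μ ν, μ ≠ ν → ∀ y ∈ S, plaq Mt B μ ν y = plaq Mt (QvOp n Mt *ᵥ A) μ ν y)
    (hT : ∀ μ ν, μ ≠ ν → ∀ y ∈ S, y ∈ T ∧ y + unitVec Mt μ ∈ T ∧ y + unitVec Mt ν ∈ T ∧ y + unitVec Mt μ + unitVec Mt ν ∈ T)
    (ζ : Fin d → Fin d → Tor (fine n Mt) → ℝ) (hζ0 : ∀ μ ν x, 0 ≤ ζ μ ν x)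
    (hζT : ∀ μ ν x, B5Blocks16.blockOf n Mt x ∈ T → 1 ≤ ζ μ ν x)
    {Q Qflat EA C M Rk εk nB : ℝ} (hQ : Q = Qflat + EA)
    (hflat : 1 / (n : ℝ) ^ d * (1 / 2 * ∑ μ, ∑ ν, ∑ x, ζ μ ν x * ‖Fs (fine n Mt) (n : ℂ) A μ ν x‖ ^ 2) ≤ Qflat)
    (hEA : |EA| ≤ C * (M ^ 6 * Rk * εk) * nB) (hC : 0 ≤ C) (hnB : 0 ≤ nB) :
    Ineq17 Q (B5Bounds167Lattice.d1Sq Mt B) nB 1 C M Rk εk :=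
  ineq17_flat_of_le hQ ((d1Sq_le_weighted_of_blocks n Mt A B S T hS hB hT ζ hζ0 hζT).trans hflat) hEA hC hnB

end Flat

/-! ## §4  On the box chart of `B16Ineq17BoxTorus`: (1.7) and (1.9) with `γ₀ = 1` -/

section Chart

variable {d : ℕ} {nb : Fin d → ℕ} {y : Fin d → ℤ} {D : ℕ}
variable (Mt : Fin d → ℕ) [hMt : ∀ μ, NeZero (Mt μ)] (n : ℕ) [NeZero n]

omit hMt [NeZero n] in
/-- **Where the curl of the extended chart field lives**: the plaquette variables of the zero extension `B̃′_a = torExt Mt x a` of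
the chart field of `Λ = box nb y` vanish at every unit plaquette `q` off the image `S₀` of the enlarged box
`box (nb + 1) (y − 1)` (a plaquette at `q` reads the bonds at `q`, `q + e_μ`, `q + e_ν`; `B16Ineq17BoxTorus.torExt_of_forall_ne`).
[cite: Balaban1989LargeFieldII, (1.7)–(1.8) p.358] -/
theorem plaq_torExt_eq_zero_of_not_mem (x : chartSet nb y D → ℝ) (a : Fin D) (μ ν : Fin d) {q : Tor Mt}
    (hq : q ∉ (box (fun i => nb i + 1) (fun i => y i - 1)).image (toTor Mt y)) :
    plaq Mt (torExt Mt x a) μ ν q = 0 := by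
  -- every site of `Λ` and of `Λ − e_κ` lies in the enlarged box
  have hbig : ∀ z ∈ box nb y, ∀ w : Fin d → ℤ, (∀ i, w i = z i ∨ w i = z i - 1) →
      w ∈ box (fun i => nb i + 1) (fun i => y i - 1) := by
    intro z hz w hw
    simp only [B16Eq18Proof.mem_box] at hz ⊢
    intro i
    have := hz i
    rcases hw i with h | h <;> · rw [h]; push_cast; omega
  have h0 : ∀ z ∈ box nb y, toTor Mt y z ≠ q := fun z hz h =>
    hq (Finset.mem_image.2 ⟨z, hbig z hz z (fun i => Or.inl rfl), h⟩)
  have hκ : ∀ κ : Fin d, ∀ z ∈ box nb y, toTor Mt y z ≠ q + unitVec Mt κ := by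
    intro κ z hz h
    have hz' : z - B6BondElimination.unitVec κ ∈ box (fun i => nb i + 1) (fun i => y i - 1) :=
      hbig z hz _ fun i => by
        rw [Pi.sub_apply, B6BondElimination.unitVec_apply]
        by_cases hi : i = κ
        · exact Or.inr (by rw [if_pos hi])
        · exact Or.inl (by rw [if_neg hi, sub_zero])
    have h' : toTor Mt y (z - B6BondElimination.unitVec κ) = q := by
      have he := B16Ineq17BoxTorus.toTor_add_unitVec Mt y (z - B6BondElimination.unitVec κ) κ
      rw [sub_add_cancel] at he
      rw [he] at h
      exact add_right_cancel h
    exact hq (Finset.mem_image.2 ⟨_, hz', h'⟩)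
  rw [plaq_apply, B16Ineq17BoxTorus.torExt_of_forall_ne Mt x a h0 μ, B16Ineq17BoxTorus.torExt_of_forall_ne Mt x a h0 ν,
    B16Ineq17BoxTorus.torExt_of_forall_ne Mt x a (hκ μ) ν, B16Ineq17BoxTorus.torExt_of_forall_ne Mt x a (hκ ν) μ]
  ring

omit [NeZero n] in
/-- **(1.7) ON THE BOX CHART FROM A `d1Sq`-DOMINATION** (p26's `ineq17_chart_lattice` with its perturbation letter `hpert` against
`formDk` REPLACED): at a chart point `x` of the `B′`-integral (1.2) over `Λ = box nb y ⊂ T` (`nb_μ ≤ Mt_μ`), if `Q = Q^{flat} + E_A`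
with `Σ_a ⟨∂₁B̃′_a, ∂₁B̃′_a⟩ ≤ Q^{flat}` for the zero-extended chart field `B̃′_a = torExt Mt x a` (§2∕§3 deliver this from the
flat form) and `|E_A| ≤ C·M⁶R_kε_k·‖x‖²`, then `Ineq17 Q (Σ_{p∈Λ}Σ_a|(∂B′_a)(p)|²) ‖x‖² 1 C M R_k ε_k` — the hypothesis `h17` of
`B16Ineq19BoxChart.ineq19_chart_of_17` with `γ₀ = 1` (`B16Ineq17BoxTorus.boxPlaq_vec_le_sum_d1Sq`: the plaquettes of `Λ` embed).
[cite: Balaban1989LargeFieldII, (1.7)–(1.8) p.358] -/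
theorem ineq17_chart_of_sum_d1Sq_le (hn : ∀ i, nb i ≤ Mt i) (x : chartSet nb y D → ℝ) {Q Qflat EA C M Rk εk : ℝ}
    (hQ : Q = Qflat + EA) (hflat : ∑ a, B5Bounds167Lattice.d1Sq Mt (torExt Mt x a) ≤ Qflat)
    (hEA : |EA| ≤ C * (M ^ 6 * Rk * εk) * sqN x) (hC : 0 ≤ C) :
    Ineq17 Q (∑ p ∈ innerPlaq nb y, ∑ a, B6TreeGaugePoincare.curl (fun b => ext x b a) p.1 p.2.1 p.2.2 ^ 2)
      (sqN x) 1 C M Rk εk :=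
  ineq17_flat_of_le hQ ((boxPlaq_vec_le_sum_d1Sq Mt hn x).trans hflat) hEA hC (sqN_nonneg x)

/-- ★★ **(1.7) ON THE BOX CHART AT FLAT BACKGROUND, `γ₀ = 1`**: at a chart point `x` (`Λ = box nb y ⊂ T`, `nb_μ ≤ Mt_μ`), with
`S₀` = the image of the enlarged box (where `∂₁B̃′` lives, `plaq_torExt_eq_zero_of_not_mem`), given per 𝔤-coordinate `a` a fine
field `A_a` on `T_η` whose block averages reproduce the zero-extended chart field `B̃′_a = torExt Mt x a` on the plaquettes of
`S₀` (U2b: the linearised `Z`-constraint near `Λ`), plane weights `ζ ≥ 0` that are `≥ 1` on the blocks of a set `T` containing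
the four corners of every plaquette of `S₀` (print: `ζ₀ ≡ 1` near `Λ`), and a form `Q = Q^{flat} + E_A` with
`Q^{flat} ≥ Σ_a η^d·½Σ_{μ,ν}Σ_z ζ_{μν}(z)‖F^η_{μν}(A_a)(z)‖²` (U2a: the leading term at background `1`) and `|E_A| ≤ C·M⁶R_kε_k·‖x‖²`
(letter (b)): `Ineq17 Q (Σ_{p∈Λ}Σ_a|(∂B′_a)(p)|²) ‖x‖² 1 C M R_k ε_k`.  This is p26's `ineq17_chart_lattice` with
`γ₀ = (4/π²)^{d+2}` ↦ `1` and the letter `hpert` ((a)+(b)+(c) of r13) ↦ (b) alone + the two flat identifications.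
[cite: Balaban1989LargeFieldII, (1.6)–(1.8) pp.357–358; Federbush1986PhaseCellI, 'Abelian Stability Theorem' (0.12) p.321] -/
theorem ineq17_chart_flat (hn : ∀ i, nb i ≤ Mt i) (x : chartSet nb y D → ℝ)
    (A : Fin D → (Tor (fine n Mt) × Fin d → ℂ)) (T : Finset (Tor Mt))
    (hB : ∀ a μ ν, μ ≠ ν → ∀ q ∈ (box (fun i => nb i + 1) (fun i => y i - 1)).image (toTor Mt y),
      plaq Mt (torExt Mt x a) μ ν q = plaq Mt (QvOp n Mt *ᵥ A a) μ ν q)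
    (hT : ∀ μ ν, μ ≠ ν → ∀ q ∈ (box (fun i => nb i + 1) (fun i => y i - 1)).image (toTor Mt y),
      q ∈ T ∧ q + unitVec Mt μ ∈ T ∧ q + unitVec Mt ν ∈ T ∧ q + unitVec Mt μ + unitVec Mt ν ∈ T)
    (ζ : Fin d → Fin d → Tor (fine n Mt) → ℝ) (hζ0 : ∀ μ ν z, 0 ≤ ζ μ ν z)
    (hζT : ∀ μ ν z, B5Blocks16.blockOf n Mt z ∈ T → 1 ≤ ζ μ ν z)
    {Q Qflat EA C M Rk εk : ℝ} (hQ : Q = Qflat + EA)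
    (hflat : ∑ a, 1 / (n : ℝ) ^ d * (1 / 2 * ∑ μ, ∑ ν, ∑ z, ζ μ ν z * ‖Fs (fine n Mt) (n : ℂ) (A a) μ ν z‖ ^ 2) ≤ Qflat)
    (hEA : |EA| ≤ C * (M ^ 6 * Rk * εk) * sqN x) (hC : 0 ≤ C) :
    Ineq17 Q (∑ p ∈ innerPlaq nb y, ∑ a, B6TreeGaugePoincare.curl (fun b => ext x b a) p.1 p.2.1 p.2.2 ^ 2)
      (sqN x) 1 C M Rk εk :=
  ineq17_chart_of_sum_d1Sq_le Mt hn x hQ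
    ((Finset.sum_le_sum fun a _ => d1Sq_le_weighted_of_blocks n Mt (A a) (torExt Mt x a) _ T
      (fun μ ν _ _ hq => plaq_torExt_eq_zero_of_not_mem Mt x a μ ν hq) (hB a) hT ζ hζ0 hζT).trans hflat) hEA hC

omit [NeZero n] in
/-- **(1.9) ON THE BOX CHART WITH `γ₀ = 1`**: for `Λ = box nb y` with sides `nb_i ≤ 100M` inside the torus (`nb_i ≤ Mt_i`), `1 ≤ d`,
a form `Q = Q^{flat} + E_A` on the chart with `Σ_a ⟨∂₁B̃′_a, ∂₁B̃′_a⟩ ≤ Q^{flat}(x)` and `|E_A(x)| ≤ C·M⁶R_kε_k·‖x‖²` at every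
point, and *«for g_k sufficiently small»* — here `C(M⁶R_kε_k + e^{−R_k}) ≤ 1/(2d(100M)^{d+1})`, print's `γ₀` being `1` —:
`Ineq19 (Q x) ‖x‖² 1 d M` at every chart point, i.e. `⟨H_{1,k}B′, Δ₁(ζ₀)H_{1,k}B′⟩ ≥ ‖B′‖²/(2d(100M)^{d+1})`, by
`B16Ineq19BoxChart.ineq19_chart_of_17` ((1.8) on the box, p30∕r13) ∘ `ineq17_chart_of_sum_d1Sq_le`.
[cite: Balaban1989LargeFieldII, (1.7)–(1.9) p.358] -/
theorem ineq19_chart_of_sum_d1Sq_le {M : ℕ} (hM : 1 ≤ M) (hn100 : ∀ i, nb i ≤ 100 * M) (hd : 1 ≤ d)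
    (hn : ∀ i, nb i ≤ Mt i) (Q Qflat EA : (chartSet nb y D → ℝ) → ℝ) {C Rk εk : ℝ} (hC : 0 ≤ C)
    (hQ : ∀ x, Q x = Qflat x + EA x)
    (hflat : ∀ x, ∑ a, B5Bounds167Lattice.d1Sq Mt (torExt Mt x a) ≤ Qflat x)
    (hEA : ∀ x, |EA x| ≤ C * ((M : ℝ) ^ 6 * Rk * εk) * sqN x)
    (hsmall : C * ((M : ℝ) ^ 6 * Rk * εk + Real.exp (-Rk)) ≤ 1 / (2 * d * (100 * (M : ℝ)) ^ (d + 1))) :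
    ∀ x, Ineq19 (Q x) (sqN x) 1 d (M : ℝ) :=
  ineq19_chart_of_17 hM hn100 hd zero_le_one Q
    (fun x => ineq17_chart_of_sum_d1Sq_le Mt hn x (hQ x) (hflat x) (hEA x) hC) hsmall

end Chart

/-! ## §5  The `n′ = 1` reading: the ONE-SIDED `formDk`-shaped letter from the flat route -/

section OneSided

variable {d : ℕ} (Mt : Fin d → ℕ) [hMt : ∀ μ, NeZero (Mt μ)]

/-- ★ **THE ONE-SIDED `formDk` LETTER AT STEP `n′ = 1` FROM THE FLAT ROUTE.**  r02's `formDk n′ Mt` at block side `n′ = 1` IS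
`d1Sq Mt` (β sub-cell `Beta.MonotoneScales.formDk_one`: no averaging step, the (1.66) weight is `1`).  Hence, for any finite family
of unit-lattice fields `B_a` (the 𝔤-coordinates of `B′`) and a form `Q = Q^{flat} + E_A` with `Σ_a ⟨∂₁B_a, ∂₁B_a⟩ ≤ Q^{flat}` (§2 ∕ §4)
and `|E_A| ≤ C_err·‖B′‖²`: `Σ_a formDk 1 Mt (B_a) − C_err·‖B′‖² ≤ Q` — the LOWER HALF of the N12∕s1 chain's letter `hlead`
(`B15Prop1Thm1GeneralFormShapes` §4: `|Q − Σ_a formDk n′ Mt …| ≤ C_err‖X‖²`, `n′ ≥ 1` free) at `n′ := 1`, which is the only half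
its consumer `B15Prop1SliceIneq167.ineq17_of_lead` uses.  The two-sided `hlead` is print's route ((a)+(c) of r13) and is NOT implied
by the flat route. [cite: Balaban1989LargeFieldII, (1.7) pp.357–358; Balaban1984PropagatorsI, (1.66)–(1.67) p.29] -/
theorem sum_formDk_one_sub_le {ι : Type*} [Fintype ι] (B : ι → (Tor Mt × Fin d → ℂ)) {Q Qflat EA Cerr nB : ℝ}
    (hQ : Q = Qflat + EA) (hflat : ∑ a, B5Bounds167Lattice.d1Sq Mt (B a) ≤ Qflat) (hEA : |EA| ≤ Cerr * nB) :
    ∑ a, B5Bounds167Lattice.formDk 1 Mt (B a) - Cerr * nB ≤ Q := by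
  have h1 : ∑ a, B5Bounds167Lattice.formDk 1 Mt (B a) = ∑ a, B5Bounds167Lattice.d1Sq Mt (B a) :=
    Finset.sum_congr rfl fun a _ => Beta.MonotoneScales.formDk_one Mt (B a)
  rw [h1, hQ]
  have h2 := (abs_le.mp hEA).1
  linarith

/-- **The same on p26's box chart**: for the zero-extended chart field `B̃′_a = torExt Mt x a` and `‖B′‖² = sqN x`,
`Σ_a formDk 1 Mt (B̃′_a) − C_err·‖x‖² ≤ Q` from the flat-form domination `Σ_a ⟨∂₁B̃′_a, ∂₁B̃′_a⟩ ≤ Q^{flat}` and `|E_A| ≤ C_err‖x‖²` —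
p26's `hpert` letter (two-sided, `n_k ≥ 1`) weakened to the half `ineq17_chart_lattice` actually consumes, at `n_k := 1`.
[cite: Balaban1989LargeFieldII, (1.7) pp.357–358] -/
theorem sum_formDk_one_torExt_sub_le {nb : Fin d → ℕ} {y : Fin d → ℤ} {D : ℕ} (x : chartSet nb y D → ℝ)
    {Q Qflat EA Cerr : ℝ} (hQ : Q = Qflat + EA) (hflat : ∑ a, B5Bounds167Lattice.d1Sq Mt (torExt Mt x a) ≤ Qflat)
    (hEA : |EA| ≤ Cerr * sqN x) :
    ∑ a, B5Bounds167Lattice.formDk 1 Mt (torExt Mt x a) - Cerr * sqN x ≤ Q :=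
  sum_formDk_one_sub_le Mt (fun a => torExt Mt x a) hQ hflat hEA

end OneSided

end Literature.MathematicalPhysics.QuantumFieldTheory.Balaban1983to89.B16Ineq17LocalFederbush

end
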